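import Mathlib
import Summits.NavierStokesRegularity.NavierStokesRegularity.Theorems.ThreadingFluxLoopLawBracketSlotPair
import Summits.NavierStokesRegularity.NavierStokesRegularity.Theorems.ThreadingFluxHorizonTowerZonalAssembly
import Summits.NavierStokesRegularity.NavierStokesRegularity.Theorems.ThreadingFluxLoopLawSameDegreeBracketRigidity
import HarnessLib

/-!
# Crux `PoloidalLiouville` (stmt-NavierStokesRegularity-1222, W1/W2), crux idea «horizon-threading-tower» (ns-idea-15):
# TWO-SHELL HORIZON TOWERS AT ORDER ONE — the two-degree slot-pair identity and the ZONAL-PARTNER LEMMA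
# (toward the tower form `HorizonTower.HorizonTowerZonality`, ThreadingFluxHorizonTowerDefs l.254, the card's boldest line)

Support file (`--supports stmt-NavierStokesRegularity-1222`, helper; cell `ns-wall-extremal`, width hand ns-wall-eng-3 g3; 0 kit).  For a
two-shell scale-free profile `U = U_{H_l} + U_{H_m}` (`l ≠ m`) the ORDER-ONE horizon law `𝔏₁ ≡ 0` is the mixed-degree loop bracket
`{H_l, H_m} = det(y, ∇H_l, ∇H_m) ≡ 0` (`OrderOneSphereEuler`, p679165: `{Δ_S Φ, Φ} = 0` with two eigen-components).  This file proves
the decidable half of the resulting rigidity in the kernel, uniformly in the degrees, with the azimuthal-weight slot machinery of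
ns-wall-eng-5 g4 (`…ZonalAlgebra/Slot/Descent`) and the pair tools of `…LoopLawBracketSlots/SlotPair` (this seat, p683612/p683980):

* `eval_tripleC_slots_two_degrees` — THE SLOT-PAIR IDENTITY FOR TWO DEGREES: for `Δ̃`-harmonic slots `X` (weight `M ≥ 0`, degree `l₁`),
  `Y` (weight `M' ≥ 0`, degree `l₂`): `2(M+1)(M'+1)·tripleC X Y (1,0,1) = [M(M+1)·l₂(l₂+1) − M'(M'+1)·l₁(l₁+1)]·a₀b₀`; hence
  `weights_of_tripleC_slots_eq_zero`: `tripleC X Y = 0` with `X, Y ≠ 0` forces `M(M+1)l₂(l₂+1) = M'(M'+1)l₁(l₁+1)`;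
* ★ `isWeightedHomogeneous_zero_of_tripleC_weightZero` — a `Δ̃`-harmonic `Q` with `tripleC P Q = 0` against a non-zero `Δ̃`-harmonic `P`
  of pure weight `0` and degree `≥ 1` has pure weight `0` (top weight by the identity, bottom weight by the mirror);
* `coeff_lam`, `isWeightedHomogeneous_zero_of_lam_eq_zero`, `lam_eq_zero_of_weight_zero` — weight `0` ⇔ `Λ = 0`;
* ★★ `zonal_partner_of_bracket` — REAL FORM: two real solid harmonics `A ≠ 0` (degree `l ≥ 1`), `B` (degree `m`) with
  `det(y, ∇A, ∇B) ≡ 0`; if `A` is axisymmetric about `u × v` then so is `B` (frame transport `frameIso`, `θ`, `tripleC_theta`, back by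
  `inner_cross_gradient_of_frame`).  So a two-shell tower with one zonal shell that passes ORDER ONE is coaxially zonal (and then passes
  order two by `horizonL2Zonal`, p676078).  The converse half («{H_l, H_m} = 0, l ≠ m ⇒ a common axis exists») is NOT claimed here.

HONEST FRAME: finite-dimensional algebra about one crux idea's typed objects, information-grade; `HorizonTowerZonality` (conjecture),
`PoloidalLiouville` (1222), `UnthreadedRigidity` (27585), 23843 and NS regularity stay OPEN; W1/W2 movement 0.  [folklore]
-/

-- the summit and its single problem share the name (D-0017 nested layout)
set_option linter.dupNamespace false

noncomputable section

open MvPolynomial Finsupp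

namespace Summit.NavierStokesRegularity.NavierStokesRegularity.Theorems.PoloidalLiouville.HorizonTower.Zonal

/-! ### The slot-pair identity for two degrees -/

section TwoDegrees

/-- **Slot pair, two degrees, closed form at the axis point**: for `Δ̃`-harmonic slots `X` (weight `M ≥ 0`, degree `l₁ = M + dd`) and `Y`
(weight `M' ≥ 0`, degree `l₂ = M' + dd'`),
`2(M+1)(M'+1) · tripleC X Y (1,0,1) = [M(M+1)·l₂(l₂+1) − M'(M'+1)·l₁(l₁+1)] · a₀ b₀`. -/
theorem eval_tripleC_slots_two_degrees {X Y : CPoly} {M M' dd dd' : ℕ}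
    (hXw : IsWeightedHomogeneous wt X (M : ℤ)) (hXh : X.IsHomogeneous (M + dd)) (hXl : lapC X = 0)
    (hYw : IsWeightedHomogeneous wt Y (M' : ℤ)) (hYh : Y.IsHomogeneous (M' + dd')) (hYl : lapC Y = 0) :
    2 * ((M : ℂ) + 1) * ((M' : ℂ) + 1) * eval axisPt (tripleC X Y)
      = ((M : ℂ) * (M + 1) * ((M' : ℂ) + dd') * ((M' : ℂ) + dd' + 1)
          - (M' : ℂ) * (M' + 1) * ((M : ℂ) + dd) * ((M : ℂ) + dd + 1))
        * (coeff (sx M dd 0) X * coeff (sx M' dd' 0) Y) := by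
  set a0 := coeff (sx M dd 0) X with ha0
  set a1 := coeff (sx M dd 1) X with ha1
  set b0 := coeff (sx M' dd' 0) Y with hb0
  set b1 := coeff (sx M' dd' 1) Y with hb1
  have RX := slot_recursion_zero (M := M) (dd := dd) hXh hXl
  have RY := slot_recursion_zero (M := M') (dd := dd') hYh hYl
  rw [← ha0, ← ha1] at RX
  rw [← hb0, ← hb1] at RY
  rw [tripleC, lam_eq_smul_of_isWeightedHomogeneous hXw, lam_eq_smul_of_isWeightedHomogeneous hYw, smul_eq_C_mul,
    smul_eq_C_mul]
  simp only [map_add, map_sub, map_mul, eval_C, eval_X, axisPt_two, jet_val hXw hXh, jet_val hYw hYh, jet_d0' hXw hXh,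
    jet_d0' hYw hYh, jet_d1 hXw hXh, jet_d1 hYw hYh, jet_d2' hXw hXh, jet_d2' hYw hYh]
  rw [← ha0, ← ha1, ← hb0, ← hb1]
  push_cast
  linear_combination (((M' : ℂ) + 1) * M' * b0) * RX - (((M : ℂ) + 1) * M * a0) * RY

/-- Two-degree slot pair: if `tripleC X Y = 0` for non-zero `Δ̃`-harmonic slots (weights `M, M' ≥ 0`, degrees `l₁, l₂`) then
`M(M+1)·l₂(l₂+1) = M'(M'+1)·l₁(l₁+1)`. -/
theorem weights_of_tripleC_slots_eq_zero {X Y : CPoly} {M M' dd dd' : ℕ}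
    (hXw : IsWeightedHomogeneous wt X (M : ℤ)) (hXh : X.IsHomogeneous (M + dd)) (hXl : lapC X = 0) (hX0 : X ≠ 0)
    (hYw : IsWeightedHomogeneous wt Y (M' : ℤ)) (hYh : Y.IsHomogeneous (M' + dd')) (hYl : lapC Y = 0) (hY0 : Y ≠ 0)
    (hT : tripleC X Y = 0) :
    M * (M + 1) * ((M' + dd') * (M' + dd' + 1)) = M' * (M' + 1) * ((M + dd) * (M + dd + 1)) := by
  have h := eval_tripleC_slots_two_degrees hXw hXh hXl hYw hYh hYl
  rw [hT, map_zero, mul_zero] at h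
  have ha : coeff (sx M dd 0) X ≠ 0 := coeff_sx_zero_ne_zero hXw hXh hXl hX0
  have hb : coeff (sx M' dd' 0) Y ≠ 0 := coeff_sx_zero_ne_zero hYw hYh hYl hY0
  have h2 := (mul_eq_zero.mp h.symm).resolve_right (mul_ne_zero ha hb)
  have h3 : ((M * (M + 1) * ((M' + dd') * (M' + dd' + 1)) : ℕ) : ℂ) = ((M' * (M' + 1) * ((M + dd) * (M + dd + 1)) : ℕ) : ℂ) := by
    push_cast
    linear_combination h2
  exact_mod_cast h3

end TwoDegrees

/-! ### The zonal-partner lemma: a harmonic polynomial `tripleC`-commuting with a non-zero weight-0 harmonic has weight 0 -/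

section Partner

variable {P Q : CPoly} {l m : ℕ}

/-- Step: no POSITIVE weights in `Q`. -/
theorem wb_zero_of_tripleC_weightZero (hPw : IsWeightedHomogeneous wt P 0) (hPh : P.IsHomogeneous l) (hPl : lapC P = 0)
    (hP0 : P ≠ 0) (hl : 1 ≤ l) (hQh : Q.IsHomogeneous m) (hQl : lapC Q = 0) (hT : tripleC P Q = 0) : WB 0 Q := by
  classical
  by_cases hQ0 : Q = 0
  · rw [hQ0]; exact WB.zero 0
  obtain ⟨μ, hQμ, hQtop⟩ := exists_top_weight hQ0
  rcases le_or_gt μ 0 with hμ | hμ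
  · exact hQμ.mono hμ
  · exfalso
    -- the top slot of `Q` against `P`
    have hXw : IsWeightedHomogeneous wt (weightedHomogeneousComponent wt μ Q) μ :=
      weightedHomogeneousComponent_isWeightedHomogeneous μ Q
    have hXh : (weightedHomogeneousComponent wt μ Q).IsHomogeneous m := isHomogeneous_wcomp hQh μ
    have hXl : lapC (weightedHomogeneousComponent wt μ Q) = 0 := by rw [← wcomp_lapC, hQl, map_zero]
    obtain ⟨-, hhi⟩ := weight_le_degree hXw hXh hQtop
    obtain ⟨M, rfl⟩ : ∃ M : ℕ, μ = M := ⟨μ.toNat, (Int.toNat_of_nonneg hμ.le).symm⟩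
    obtain ⟨dd, rfl⟩ : ∃ dd : ℕ, m = M + dd := ⟨m - M, by omega⟩
    have hTop : tripleC (weightedHomogeneousComponent wt (M : ℤ) Q) P = 0 := by
      have h := wcomp_tripleC_top hQμ (WB.of_isWeightedHomogeneous hPw)
      rw [tripleC_swap, hT, neg_zero, map_zero, hPw.weightedHomogeneousComponent_same] at h
      exact h.symm
    have hPh' : P.IsHomogeneous (0 + l) := by rw [zero_add]; exact hPh
    have hPw' : IsWeightedHomogeneous wt P ((0 : ℕ) : ℤ) := by exact_mod_cast hPw
    have key := weights_of_tripleC_slots_eq_zero hXw hXh hXl hQtop hPw' hPh' hPl hP0 hTop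
    simp only [zero_mul, zero_add] at key
    have h1 : 1 ≤ M := by exact_mod_cast hμ
    have : 0 < M * (M + 1) * (l * (l + 1)) := by positivity
    omega

/-- ★ **Zonal-partner lemma** (complex-coordinate form): a `Δ̃`-harmonic homogeneous `Q` with `tripleC P Q = 0` against a NON-ZERO `Δ̃`-harmonic
`P` of pure weight `0` and degree `≥ 1` is itself of pure weight `0` (top weight by the two-degree slot-pair identity, bottom weight by the
mirror). -/
theorem isWeightedHomogeneous_zero_of_tripleC_weightZero (hPw : IsWeightedHomogeneous wt P 0) (hPh : P.IsHomogeneous l)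
    (hPl : lapC P = 0) (hP0 : P ≠ 0) (hl : 1 ≤ l) (hQh : Q.IsHomogeneous m) (hQl : lapC Q = 0) (hT : tripleC P Q = 0) :
    IsWeightedHomogeneous wt Q 0 := by
  classical
  have h1 : WB 0 Q := wb_zero_of_tripleC_weightZero hPw hPh hPl hP0 hl hQh hQl hT
  -- mirror
  have hPw' : IsWeightedHomogeneous wt (mirror P) 0 := by simpa using isWeightedHomogeneous_mirror hPw
  have hPl' : lapC (mirror P) = 0 := by rw [mirror_lapC, hPl, map_zero]
  have hQl' : lapC (mirror Q) = 0 := by rw [mirror_lapC, hQl, map_zero]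
  have hP0' : mirror P ≠ 0 := fun h => hP0 ((mirror_eq_zero_iff P).mp h)
  have hT' : tripleC (mirror P) (mirror Q) = 0 := by rw [mirror_tripleC, hT, map_zero, neg_zero]
  have h2 : WB 0 (mirror Q) :=
    wb_zero_of_tripleC_weightZero hPw' hPh.rename_isHomogeneous hPl' hP0' hl hQh.rename_isHomogeneous hQl' hT'
  intro d hd
  have hle := h1 d hd
  have hge := h2 (d.mapDomain (Equiv.swap (0 : Fin 3) 1)) (by rw [coeff_mirror]; exact hd)
  rw [weight_mapDomain_swap] at hge
  exact le_antisymm hle (by omega)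

end Partner

/-! ### Weight zero ⇔ `Λ = 0` -/

section Lam

variable {P : CPoly}

/-- Coefficients of `ΛP`: `coeff d (ΛP) = (d₀ − d₁)·coeff d P`. [folklore] -/
theorem coeff_lam (P : CPoly) (d : Fin 3 →₀ ℕ) : coeff d (lam P) = ((d 0 : ℂ) - d 1) * coeff d P := by
  classical
  have key : ∀ i : Fin 3, coeff d (X i * pderiv i P) = (d i : ℂ) * coeff d P := by
    intro i
    rw [coeff_X_mul']
    split_ifs with hi
    · rw [coeff_pderiv]
      have hdi : 1 ≤ d i := Nat.one_le_iff_ne_zero.mpr (Finsupp.mem_support_iff.mp hi)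
      have : d - single i 1 + single i 1 = d := by
        ext j
        simp only [Finsupp.coe_add, Finsupp.coe_tsub, Pi.add_apply, Pi.sub_apply, single_apply]
        split_ifs with hij
        · subst hij; omega
        · omega
      rw [this]
      have : (((d - single i 1 : Fin 3 →₀ ℕ) i : ℕ) : ℂ) + 1 = d i := by
        rw [Finsupp.tsub_apply, single_eq_same, Nat.cast_sub hdi]; push_cast; ring
      rw [this]; ring
    · have : d i = 0 := by simpa using hi
      rw [this]; simp
  rw [lam, coeff_sub, key 0, key 1]; ring

/-- `ΛP = 0` forces pure weight `0`. -/
theorem isWeightedHomogeneous_zero_of_lam_eq_zero (h : lam P = 0) : IsWeightedHomogeneous wt P 0 := by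
  intro d hd
  have hc := coeff_lam P d
  rw [h, coeff_zero] at hc
  have h0 : ((d 0 : ℂ) - d 1) = 0 := by
    rcases mul_eq_zero.mp hc.symm with h1 | h1
    · exact h1
    · exact absurd h1 hd
  rw [weight_wt]
  have h1 : (d 0 : ℂ) = (d 1 : ℂ) := sub_eq_zero.mp h0
  have h2 : d 0 = d 1 := by exact_mod_cast h1
  omega

/-- Pure weight `0` gives `ΛP = 0`. -/
theorem lam_eq_zero_of_weight_zero (h : IsWeightedHomogeneous wt P 0) : lam P = 0 := by
  rw [lam_eq_smul_of_isWeightedHomogeneous h]; simp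

end Lam

/-! ### Real form: the ZONAL-PARTNER LEMMA about the axis `u × v` -/

section Real

open scoped RealInnerProductSpace
open Literature.Analysis.FluidPDE (cross)

/-- A real polynomial read in the frame `(u, v, u × v)`: there is a polynomial `q` (homogeneous of the same degrees) with
`X(R⁻¹ y) = q(y)`. [folklore] -/
theorem exists_poly_comp_frameIso_symm {u v : E3} (hu : ‖u‖ = 1) (hv : ‖v‖ = 1) (huv : ⟪u, v⟫ = 0)
    (X : MvPolynomial (Fin 3) ℝ) :
    ∃ q : MvPolynomial (Fin 3) ℝ, (∀ n : ℕ, X.IsHomogeneous n → q.IsHomogeneous n) ∧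
      ∀ y : E3, evalE X ((frameIso hu hv huv).symm y) = evalE q y := by
  classical
  set lin : Fin 3 → MvPolynomial (Fin 3) ℝ := fun j => ∑ i : Fin 3, C ((frameVec u v i) j) * MvPolynomial.X i with hlin
  refine ⟨bind₁ lin X, fun n hX => ?_, fun y => ?_⟩
  · have h1 : ∀ j, (lin j).IsHomogeneous 1 := fun j =>
      IsHomogeneous.sum _ _ _ fun i _ => (isHomogeneous_X ℝ i).C_mul _
    have := hX.aeval lin h1
    rw [one_mul] at this
    rw [← aeval_eq_bind₁]; exact this
  · rw [evalE, evalE]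
    change _ = eval₂Hom (RingHom.id ℝ) (fun i => y i) (bind₁ lin X)
    rw [eval₂Hom_bind₁]
    change eval (fun i => ((frameIso hu hv huv).symm y) i) X = eval (fun j => eval (fun i => y i) (lin j)) X
    have harg : (fun i => ((frameIso hu hv huv).symm y) i) = fun j => eval (fun i => y i) (lin j) := by
      funext j
      rw [frameIso_symm_apply, hlin]
      simp [Fin.sum_univ_three]
      ring
    rw [harg]

/-- ★ **ZONAL-PARTNER LEMMA** (two-shell horizon towers at order one, the decidable half): let `A ≠ 0` and `B` be real solid harmonics
of degrees `l ≥ 1` and `m` whose loop bracket `det(y, ∇A, ∇B)` vanishes identically; if `A` is axisymmetric about `n = u × v`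
(`⟪n × x, ∇A(x)⟫ ≡ 0`), then so is `B`.  (For a two-shell profile `U = U_{H_l} + U_{H_m}`, `l ≠ m`, the order-one horizon law is
`{H_l, H_m} ≡ 0` by `OrderOneSphereEuler`; so a two-shell tower with one zonal shell is coaxially zonal, hence annihilated by `𝔏₂`
as well by `horizonL2Zonal`.) -/
theorem zonal_partner_of_bracket (l m : ℕ) (A B : MvPolynomial (Fin 3) ℝ) {u v : E3}
    (hu : ‖u‖ = 1) (hv : ‖v‖ = 1) (huv : ⟪u, v⟫ = 0) (hl : 1 ≤ l)
    (hA : A.IsHomogeneous l) (hAh : ∀ y : E3, Laplacian.laplacian (evalE A) y = 0) (hA0 : A ≠ 0)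
    (hB : B.IsHomogeneous m) (hBh : ∀ y : E3, Laplacian.laplacian (evalE B) y = 0)
    (hzon : ∀ x : E3, ⟪cross (cross u v) x, gradient (evalE A) x⟫ = 0)
    (hbr : ∀ y : E3, ⟪y, cross (gradient (evalE A) y) (gradient (evalE B) y)⟫ = 0) :
    ∀ x : E3, ⟪cross (cross u v) x, gradient (evalE B) x⟫ = 0 := by
  classical
  set R := frameIso hu hv huv with hR
  obtain ⟨qA, hqAh, hqA⟩ := exists_poly_comp_frameIso_symm hu hv huv A
  obtain ⟨qB, hqBh, hqB⟩ := exists_poly_comp_frameIso_symm hu hv huv B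
  rw [← hR] at hqA hqB
  have hKA : (fun y => evalE A (R.symm y)) = evalE qA := funext hqA
  have hKB : (fun y => evalE B (R.symm y)) = evalE qB := funext hqB
  -- harmonicity
  have hlapA : lapP qA = 0 := by
    refine eq_zero_of_evalE_eq_zero fun y => ?_
    rw [← laplacian_evalE, ← hKA]; exact harmonic_comp_frameIso_symm hu hv huv hAh y
  have hlapB : lapP qB = 0 := by
    refine eq_zero_of_evalE_eq_zero fun y => ?_
    rw [← laplacian_evalE, ← hKB]; exact harmonic_comp_frameIso_symm hu hv huv hBh y
  -- zonality of `A` in the frame: `rotP qA = 0`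
  have hrotA : rotP qA = 0 := by
    refine eq_zero_of_evalE_eq_zero fun y => ?_
    rw [← rot_evalE, ← hKA, gradient_comp_frameIso_symm, ← hR]
    have h := hzon (R.symm y)
    rw [← frameIso_symm_cross_single_two hu hv huv (R.symm y), ← hR, LinearIsometryEquiv.apply_symm_apply,
      ← R.inner_map_map, LinearIsometryEquiv.apply_symm_apply] at h
    exact h
  -- the bracket in the frame: `detP qA qB = 0`
  have hdet : detP qA qB = 0 := by
    refine eq_zero_of_evalE_eq_zero fun y => ?_
    rw [← LoopLaw.loopBracket_evalE, ← hKA, ← hKB, gradient_comp_frameIso_symm, gradient_comp_frameIso_symm, ← hR]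
    have key := inner_cross_frameIso hu hv huv (R.symm y) (gradient (evalE A) (R.symm y)) (gradient (evalE B) (R.symm y))
    rw [← hR, LinearIsometryEquiv.apply_symm_apply, hbr, mul_zero] at key
    exact key
  -- `qA ≠ 0`
  have hqA0 : qA ≠ 0 := by
    intro h
    apply hA0
    refine eq_zero_of_evalE_eq_zero fun x => ?_
    have := hqA (R x)
    rw [LinearIsometryEquiv.symm_apply_apply, h, evalE_zero] at this
    exact this
  -- complexify
  set PA := theta (map (algebraMap ℝ ℂ) qA) with hPA
  set PB := theta (map (algebraMap ℝ ℂ) qB) with hPB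
  have hPAh : PA.IsHomogeneous l := isHomogeneous_theta ((hqAh l hA).map _)
  have hPBh : PB.IsHomogeneous m := isHomogeneous_theta ((hqBh m hB).map _)
  have hPAl : lapC PA = 0 := by rw [hPA, lapC_theta, ← map_lapP, hlapA, map_zero, map_zero]
  have hPBl : lapC PB = 0 := by rw [hPB, lapC_theta, ← map_lapP, hlapB, map_zero, map_zero]
  have hT : tripleC PA PB = 0 := by
    rw [hPA, hPB, tripleC_theta, ← map_detP, hdet, map_zero, map_zero, mul_zero]
  have hPAw : IsWeightedHomogeneous wt PA 0 := by
    apply isWeightedHomogeneous_zero_of_lam_eq_zero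
    rw [hPA, lam_theta, ← map_rotP, hrotA, map_zero, map_zero, mul_zero]
  have hPA0 : PA ≠ 0 := by
    intro h
    have h1 : map (algebraMap ℝ ℂ) qA = 0 := eq_of_theta_eq _ _ (by rw [← hPA, h, map_zero])
    exact hqA0 (map_injective _ (algebraMap ℝ ℂ).injective (by rw [h1, map_zero]))
  -- partner lemma and the way back
  have hPBw : IsWeightedHomogeneous wt PB 0 := isWeightedHomogeneous_zero_of_tripleC_weightZero hPAw hPAh hPAl hPA0 hl hPBh hPBl hT
  have hrotB : rotP qB = 0 := by
    have h := lam_eq_zero_of_weight_zero hPBw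
    rw [hPB, lam_theta, neg_mul, neg_eq_zero, mul_eq_zero] at h
    rcases h with h | h
    · exact absurd (C_eq_zero.mp h) Complex.I_ne_zero
    · rw [← map_rotP] at h
      have h0 : map (algebraMap ℝ ℂ) (rotP qB) = 0 := eq_of_theta_eq _ _ (by rw [h, map_zero])
      exact map_injective _ (algebraMap ℝ ℂ).injective (by rw [h0, map_zero])
  have hKrot : ∀ y : E3, ⟪cross (EuclideanSpace.single 2 (1 : ℝ)) y, gradient (fun y => evalE B (R.symm y)) y⟫ = 0 := by
    intro y; rw [hKB, rot_evalE, hrotB, evalE_zero]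
  rw [hR] at hKrot
  exact inner_cross_gradient_of_frame hu hv huv hKrot

end Real

end Summit.NavierStokesRegularity.NavierStokesRegularity.Theorems.PoloidalLiouville.HorizonTower.Zonal

end
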